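import Mathlib

/-!
# Route «KPlusLogSqLaw» — the ALTERNATING FOLD of a family of lines (definitions)

HONEST FRAMING.  Definitions file (D-0009: reviewed/audited) for the support theorem
`…Theorems.KPlusLogSqLaw.StaticPathFold.card_changes_le` (companion proof file `KPlusLogSqLawStaticPathFold.lean`) toward the
crux `WeakLifting` (item `stmt-ValiantsHypothesis-19561`, route `KPlusLogSqLaw`; cell `pub-symmetroid`, seat val-sym-lift-p3 g6,
2026-08-27), on the line of its registered witness-plan stub `stub_tridiagonalSectorB`: the TROPICAL TWIN of the STATIC tridiagonal
sector is parametric maximum-weight matching on a path (val-sym-lift-p4 g6, `HOME/val-sym-lift-p4/STATIC-PATH-NLOGN.md`, evidence on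
19561), whose «left train» is read off the ALTERNATING FOLD of the signed prefix-sum lines `S_0, …, S_n`:
`μ_0 = S_0`, `μ_k = max (S_k, μ_{k-1})` for odd `k`, `min` for even `k`; the number of linear pieces of `μ_n` (paper Theorem P2:
`≤ 2n` under general position) is the key to the `O(n log n)` bound on the breakpoints of that parametric problem.
This file only NAMES the bookkeeping for `n + 1` arbitrary lines `L t θ = a t * θ + b t` — the fold `fold`, its ACTIVE INDEX `lab`
(the last index at which the fold equals the new line), the signed gap `gap` (a later line of even index belongs ABOVE the current
value, of odd index BELOW), and the parameter sets `I n j` / `T n i` («every later line strictly / weakly on its correct side of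
line `j` / `i`») — and records the two defining equations of the fold.  No candidate law, no `Prop` is asserted; nothing here bears
on `WeakLifting`, `TropicalB`, `KPlusLogSqLaw`, the stub in its window, `MatrixDescartes` (stmt-ValiantsHypothesis-18050) or `VP ≠ VNP`.

[folklore] (upper/lower envelopes of lines; bookkeeping).
-/

-- `Summit.ValiantsHypothesis.ValiantsHypothesis.…` repeats a component by the D-0017 layout
-- (single-conjunct summit), which the `dupNamespace` linter flags; the name is mandated.
set_option linter.dupNamespace false
set_option autoImplicit false

namespace Summit.ValiantsHypothesis.ValiantsHypothesis.Theorems.KPlusLogSqLaw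

open Set Classical

namespace StaticPathFold

noncomputable section

variable (a b : ℕ → ℝ)

/-- the lines `L t θ = a t * θ + b t`. [folklore] -/
def L (t : ℕ) (θ : ℝ) : ℝ := a t * θ + b t

/-- the alternating fold: `fold 0 = L 0`, `fold (k+1) = min (L (k+1)) (fold k)` for even `k+1`,
`max (L (k+1)) (fold k)` for odd `k+1`. [folklore] -/
def fold : ℕ → ℝ → ℝ
  | 0, θ => L a b 0 θ
  | k + 1, θ => if Even (k + 1) then min (L a b (k + 1) θ) (fold k θ) else max (L a b (k + 1) θ) (fold k θ)

/-- the ACTIVE INDEX at level `k`: the last `j ≤ k` with `fold j θ = L j θ`. [folklore] -/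
def lab (k : ℕ) (θ : ℝ) : ℕ := Nat.findGreatest (fun j => fold a b j θ = L a b j θ) k

/-- the SIGNED GAP of a value `z` of line `t` against a reference value `y`: `z - y` for even `t` (line `t` belongs ABOVE),
`y - z` for odd `t` (line `t` belongs BELOW); positive iff line `t` is strictly on its correct side. [folklore] -/
def gap (t : ℕ) (y z : ℝ) : ℝ := if Even t then z - y else y - z

/-- `I n j` = parameters at which every later line `t ∈ (j, n]` is STRICTLY on its correct side of `L j`. [folklore] -/
def I (n j : ℕ) : Set ℝ := {θ | ∀ t, j < t → t ≤ n → 0 < gap t (L a b j θ) (L a b t θ)}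

/-- `T n i` = parameters at which every later line `t ∈ (i, n]` is WEAKLY on its correct side of `L i`. [folklore] -/
def T (n i : ℕ) : Set ℝ := {θ | ∀ t, i < t → t ≤ n → 0 ≤ gap t (L a b i θ) (L a b t θ)}

/-- the four interval endpoints (infimum / supremum of `I n j` and of `T n j`) attached to an index `j`. [folklore] -/
def endpts (n j : ℕ) : Finset ℝ := {sInf (I a b n j), sSup (I a b n j), sInf (T a b n j), sSup (T a b n j)}

/-- the endpoint set of the family: the union of the `endpts n j`, `j ≤ n` (at most `4 (n + 1)` reals). [folklore] -/
def B (n : ℕ) : Finset ℝ := (Finset.range (n + 1)).biUnion (endpts a b n)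

/-- defining equation of the fold at a successor level. [folklore] -/
theorem fold_succ (k : ℕ) (θ : ℝ) :
    fold a b (k + 1) θ = if Even (k + 1) then min (L a b (k + 1) θ) (fold a b k θ)
      else max (L a b (k + 1) θ) (fold a b k θ) := rfl

/-- defining equation of the fold at level `0`. [folklore] -/
theorem fold_zero (θ : ℝ) : fold a b 0 θ = L a b 0 θ := rfl

end

end StaticPathFold

end Summit.ValiantsHypothesis.ValiantsHypothesis.Theorems.KPlusLogSqLaw
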